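import Summits.ValiantsHypothesis.ValiantsHypothesis.Theorems.LacunarySymmetroidMatrixDescartesFiniteSectorRankOneRungDesign
import Summits.ValiantsHypothesis.ValiantsHypothesis.Theorems.LacunarySymmetroidMatrixDescartesFiniteSectorRealisable
import Summits.ValiantsHypothesis.ValiantsHypothesis.Theorems.LacunarySymmetroidMatrixDescartesFiniteSectorEtaTwoSix

/-!
# `MatrixDescartes` — line «finite» / «stamp»: the RANK-ONE RUNG `(m, (0,1,m+1))`, `n = 2m`, is realisable for EVERY `m`

HONEST FRAMING.  Object-search cell `pub-symmetroid`, seat val-sym-eng-3 g10 (census/instrument ENGINE #3 of D-0148 (b)).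
HELPER of the crux item `stmt-ValiantsHypothesis-18050`
(`Summit.ValiantsHypothesis.ValiantsHypothesis.Theses.LacunarySymmetroid.MatrixDescartes`, asymptotic in `K`) with NO closure
claim.  Instrument/structure tier: an ALL-`m` REALISABILITY (lower-side) statement in the `K = 3` stamp column,

* `fullyRealisable_rankOneRung (m : ℕ) : FullyRealisable m ![0, 1, m + 1] (2 * m)` —

for every size `m` there is a real symmetric half-pencil `S₀ + t S₁ + t^{m+1} S₂` on the support `(0, 1, m+1)` whose determinant
has degree exactly `2m` and `2m` distinct positive zeros.  This is the «rank-one rung» `(d-1, (0,1,d))`, `n = 2(d-1)`, with which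
every located `(0,1,d)` design ladder of the cell starts (val-sym-eng-3 g8/g9, memos `LADDER-017.md`, `LADDER-018.md` §1/§4:
located-exact for `d ≤ 13` by tridiagonal «two-front» designs; §4 there asked for the all-`m` theorem).  Read as stamp-table rows:
`ν(m,3) ≥ 2m` on the basis `(0,1,m+1)` (`not_stampLawAt_rankOneRung`) and, doubled by T2 of line «finite»
(`not_hypRootLawAt_of_fullyRealisable`), `η(m,3) ≥ 4m` (`not_hypRootLawAt_rankOneRung`); the column's ceiling
`ν(m,3) ≤ n(m,2) = ⌊(m²+6m+1)/4⌋` (`stampLawAt_K_three`) is quadratic, so this is the ENTRY rung only, never a record.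
Nothing here bears on the crux (asymptotic in `K`) or on `VP ≠ VNP`.

THE WITNESS (`…FiniteSectorRankOneRungDesign`): `S₀ + t S₁ + t^{n+2} S₂ = diag(μ_j (t - (j+1)))_{j ≤ n} + γ t^{n+2} J` at size
`n + 1`, `J` = all-ones, `μ_j = ∏_{k ≠ j} (j - k) / Q(j+1)`, `Q = ∏_{l<n} (t - (l+1)R)`, `R = (2(n+2))^{2n+3}`,
`γ = (-1)^{n+1} 2^{n+2} / R^{n+1}`; `det = (∏ μ_j)(∏_{j ≤ n} (t - (j+1)) + γ t^{n+2} Q(t))` (`det_rankOneDesign`), of degree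
`≤ 2n + 2`, and the `2n + 3` points `½, 3⁄2, …, n+3⁄2, R/2, R, 5R/2, 3R, 9R/2, 5R, …` carry the signs `(-1)^{k+n+1}`
(`rankOne_sign_low` / `rankOne_sign_high` / `rankOne_sign_node`), so `fullyRealisable_of_certificate` (…FiniteSectorRealisable)
applies.  The weights `1/μ_j` alternate in sign: `S₁` is indefinite (as `LADDER-018` §D(ii) predicted from interlacing).
Exact cross-check `m ≤ 7` (rational arithmetic, Sturm): `HOME/val-sym-eng-3/g10/tools/rankone_check.py`.
[folklore] Intermediate value theorem bookkeeping; no citation is load-bearing.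
-/

-- `Summit.ValiantsHypothesis.ValiantsHypothesis.…` repeats a component by the D-0017 layout
-- (single-conjunct summit), which the `dupNamespace` linter flags; the name is mandated.
set_option linter.dupNamespace false

namespace Summit.ValiantsHypothesis.ValiantsHypothesis.Theorems.LacunarySymmetroidMatrixDescartes.FiniteSector

open scoped BigOperators Matrix
open Polynomial Finset Matrix

/-! ## §3 Assembly: the rank-one rung for every size -/

/-- **The rank-one rung at size `n + 1`**: `FullyRealisable (n+1) ![0, 1, n+2] (2n+2)` — the design of §1 with nodes
`a_j = j + 1`, `Q = ∏_{l<n} (X - (l+1)R)`, `R = (2(n+2))^{2n+3}`, `γ = (-1)^{n+1} 2^{n+2}/R^{n+1}`, certified at the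
`2n + 3` points `k + ½` (`k ≤ n+1`), then `R/2, R, 5R/2, 3R, 9R/2, 5R, …`. [folklore] -/
theorem fullyRealisable_rankOneRung_succ (n : ℕ) :
    FullyRealisable (n + 1) (![0, 1, n + 2] : Fin 3 → ℕ) (2 * n + 2) := by
  classical
  -- the scales
  set R : ℝ := (2 * ((n : ℝ) + 2)) ^ (2 * n + 3) with hR
  set δ : ℝ := 2 ^ (n + 2) / R ^ (n + 1) with hδ
  have hn0 : (0 : ℝ) ≤ n := Nat.cast_nonneg n
  have hR2 : (2 : ℝ) * (n + 2) ≤ R := by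
    rw [hR]
    calc (2 : ℝ) * (n + 2) = (2 * ((n : ℝ) + 2)) ^ 1 := (pow_one _).symm
      _ ≤ (2 * ((n : ℝ) + 2)) ^ (2 * n + 3) := pow_le_pow_right₀ (by linarith) (by omega)
  have hRn : (n : ℝ) + 2 ≤ R := by linarith
  have hR0 : 0 < R := by linarith
  have hδ0 : 0 < δ := by rw [hδ]; positivity
  have hbig : 1 < δ * (R / 2) ^ (n + 1) := by
    have : δ * (R / 2) ^ (n + 1) = 2 := by
      rw [hδ, div_pow, pow_succ (2 : ℝ) (n + 1)]
      field_simp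
    rw [this]
    norm_num
  have hsmall : δ * ((n : ℝ) + 2) ^ (n + 2) * (((n : ℝ) + 1) * R) ^ n < (1 / 2) ^ (n + 1) := by
    have key : ((n : ℝ) + 1) ^ n < ((n : ℝ) + 2) ^ (n + 1) :=
      calc ((n : ℝ) + 1) ^ n ≤ ((n : ℝ) + 2) ^ n := pow_le_pow_left₀ (by linarith) (by linarith) n
        _ < ((n : ℝ) + 2) ^ (n + 1) := pow_lt_pow_right₀ (by linarith) (by omega)
    have hRfac : R = (2 ^ (n + 2) * 2 ^ (n + 1)) * (((n : ℝ) + 2) ^ (n + 2) * ((n : ℝ) + 2) ^ (n + 1)) := by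
      rw [hR, show 2 * n + 3 = (n + 2) + (n + 1) by ring, mul_pow]
      ring
    have hL : δ * ((n : ℝ) + 2) ^ (n + 2) * (((n : ℝ) + 1) * R) ^ n
        = 2 ^ (n + 2) * ((n : ℝ) + 2) ^ (n + 2) * ((n : ℝ) + 1) ^ n / R := by
      rw [hδ, mul_pow, pow_succ]
      have hRn0 : R ^ n ≠ 0 := pow_ne_zero _ hR0.ne'
      field_simp
      ring
    rw [hL, div_lt_iff₀ hR0]
    have h2pow : (1 / 2 : ℝ) ^ (n + 1) * 2 ^ (n + 1) = 1 := by
      rw [← mul_pow]; norm_num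
    calc (2 : ℝ) ^ (n + 2) * ((n : ℝ) + 2) ^ (n + 2) * ((n : ℝ) + 1) ^ n
        < 2 ^ (n + 2) * ((n : ℝ) + 2) ^ (n + 2) * ((n : ℝ) + 2) ^ (n + 1) :=
          mul_lt_mul_of_pos_left key (by positivity)
      _ = ((1 / 2 : ℝ) ^ (n + 1) * 2 ^ (n + 1)) * (2 ^ (n + 2) * ((n : ℝ) + 2) ^ (n + 2) * ((n : ℝ) + 2) ^ (n + 1)) := by
          rw [h2pow, one_mul]
      _ = (1 / 2 : ℝ) ^ (n + 1) * R := by rw [hRfac]; ring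
  -- the design data
  set γ : ℝ := (-1) ^ (n + 1) * δ with hγ
  set a : Fin (n + 1) → ℝ := fun j => (j : ℝ) + 1 with ha
  set Q : ℝ[X] := ∏ l : Fin n, (X - C (((l : ℝ) + 1) * R)) with hQ
  have hQeval : ∀ t : ℝ, Q.eval t = ∏ l : Fin n, (t - ((l : ℝ) + 1) * R) := fun t => by
    simp only [hQ, Polynomial.eval_prod, Polynomial.eval_sub, Polynomial.eval_X, Polynomial.eval_C]
  have hainj : Function.Injective a := by
    intro i j h
    simp only [ha] at h
    exact Fin.ext (by exact_mod_cast add_right_cancel h)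
  have hQnat : Q.natDegree = n := by
    rw [hQ, natDegree_finsetProd_X_sub_C_eq_card, Finset.card_univ, Fintype.card_fin]
  have hQmonic : Q.Monic := by
    rw [hQ]
    exact Polynomial.monic_prod_of_monic _ _ fun l _ => monic_X_sub_C (((l : ℝ) + 1) * R)
  have hQdeg : Q.degree < (n + 1 : ℕ) := by
    rw [Polynomial.degree_eq_natDegree hQmonic.ne_zero, hQnat]
    exact_mod_cast Nat.lt_succ_self n
  have hQa : ∀ j : Fin (n + 1), Q.eval (a j) ≠ 0 := by
    intro j
    rw [hQeval]
    refine Finset.prod_ne_zero_iff.2 fun l _ => ?_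
    have hj : (j : ℝ) + 1 ≤ n + 1 := by exact_mod_cast j.isLt
    have hl : (0 : ℝ) ≤ (l : ℝ) := by positivity
    have : (a j) < ((l : ℝ) + 1) * R := by simp only [ha]; nlinarith
    exact ne_of_lt (by linarith)
  set μ : Fin (n + 1) → ℝ := fun j => (∏ k ∈ univ.erase j, (a j - a k)) / Q.eval (a j) with hμ
  have hμne : ∀ j, μ j ≠ 0 := fun j => by
    simp only [hμ]
    refine div_ne_zero (Finset.prod_ne_zero_iff.2 fun k hk => ?_) (hQa j)
    exact sub_ne_zero.2 fun h => (Finset.mem_erase.1 hk).1 (hainj h).symm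
  have hprodμ : (∏ j, μ j) ≠ 0 := Finset.prod_ne_zero_iff.2 fun j _ => hμne j
  -- the determinant as a polynomial
  set p : ℝ[X] := C (∏ j, μ j) * (∏ j : Fin (n + 1), (X - C (a j)) + C γ * X ^ (n + 2) * Q) with hp
  -- the real function behind it
  have hF : ∀ t : ℝ, p.eval t = (∏ j, μ j) *
      ((∏ j : Fin (n + 1), (t - ((j : ℝ) + 1))) + (-1) ^ (n + 1) * δ * t ^ (n + 2)
        * ∏ l : Fin n, (t - ((l : ℝ) + 1) * R)) := by
    intro t
    simp only [hp, Polynomial.eval_mul, Polynomial.eval_C, Polynomial.eval_add, Polynomial.eval_prod,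
      Polynomial.eval_sub, Polynomial.eval_X, Polynomial.eval_pow, hQeval, ha, hγ]
  have heval : ∀ t : ℝ, (∑ l, t ^ (![0, 1, n + 2] : Fin 3 → ℕ) l •
      (![-Matrix.diagonal (fun j => a j * μ j), Matrix.diagonal μ,
          γ • Matrix.of (fun (_ : Fin (n + 1)) (_ : Fin (n + 1)) => (1 : ℝ))] :
            Fin 3 → Matrix (Fin (n + 1)) (Fin (n + 1)) ℝ) l).det = p.eval t := by
    intro t
    rw [rankOneDesign_eval a μ γ (n + 2) t,
      det_rankOneDesign a μ hainj Q hQdeg hQa (fun j => rfl) (γ * t ^ (n + 2)) t, hF t, hQeval, hγ]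
  -- degree
  have hdeg : p.natDegree ≤ 2 * n + 2 := by
    rw [hp]
    refine (Polynomial.natDegree_C_mul_le _ _).trans ?_
    refine (Polynomial.natDegree_add_le _ _).trans (max_le ?_ ?_)
    · rw [natDegree_finsetProd_X_sub_C_eq_card, Finset.card_univ, Fintype.card_fin]
      omega
    · refine (Polynomial.natDegree_mul_le).trans ?_
      have h1 : (C γ * X ^ (n + 2)).natDegree ≤ n + 2 :=
        (Polynomial.natDegree_C_mul_le _ _).trans (by rw [Polynomial.natDegree_X_pow])
      omega
  -- the certificate points
  set τ : Fin (2 * n + 3) → ℝ := fun k =>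
    if (k : ℕ) ≤ n + 1 then (k : ℝ) + 1 / 2
    else (if ((k : ℕ) - (n + 2)) % 2 = 0 then (((k : ℕ) - (n + 2) : ℕ) : ℝ) + 1 / 2
          else (((k : ℕ) - (n + 2) : ℕ) : ℝ)) * R with hτ
  have hτpos : ∀ k, 0 < τ k := by
    intro k
    simp only [hτ]
    split_ifs with h1 h2
    · positivity
    · positivity
    · have : 1 ≤ (k : ℕ) - (n + 2) := by omega
      have : (1 : ℝ) ≤ (((k : ℕ) - (n + 2) : ℕ) : ℝ) := by exact_mod_cast this
      nlinarith
  have hτmono : StrictMono τ := by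
    refine Fin.strictMono_iff_lt_succ.2 fun k => ?_
    have hk2 : (k : ℕ) < 2 * n + 2 := k.isLt
    simp only [hτ, Fin.val_castSucc, Fin.val_succ]
    by_cases hk : (k : ℕ) + 1 ≤ n + 1
    · rw [if_pos (by omega), if_pos hk]
      push_cast
      linarith
    · by_cases hk' : (k : ℕ) ≤ n + 1
      · -- `k = n + 1`: last low point `n + 3/2` against the first high point `R/2`
        have hkeq : (k : ℕ) = n + 1 := by omega
        rw [if_pos hk', if_neg hk, if_pos (by omega)]
        have : (((k : ℕ) + 1 - (n + 2) : ℕ) : ℝ) = 0 := by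
          rw [show (k : ℕ) + 1 - (n + 2) = 0 by omega]; simp
        rw [this, hkeq]
        push_cast
        nlinarith
      · rw [if_neg hk', if_neg hk]
        set i : ℕ := (k : ℕ) - (n + 2) with hi
        have hi' : (k : ℕ) + 1 - (n + 2) = i + 1 := by omega
        rw [hi']
        rcases Nat.mod_two_eq_zero_or_one i with he | ho
        · rw [if_pos he, if_neg (by omega)]
          push_cast
          nlinarith
        · rw [if_neg (by omega), if_pos (by omega)]
          push_cast
          nlinarith
  -- the signs `(-1)^{k+n+1} F(τ_k) > 0`
  have hsign : ∀ k : Fin (2 * n + 3), 0 < (-1 : ℝ) ^ ((k : ℕ) + (n + 1)) *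
      ((∏ j : Fin (n + 1), (τ k - ((j : ℝ) + 1))) + (-1) ^ (n + 1) * δ * (τ k) ^ (n + 2)
        * ∏ l : Fin n, (τ k - ((l : ℝ) + 1) * R)) := by
    intro k
    have hk2 : (k : ℕ) < 2 * n + 3 := k.isLt
    by_cases hk : (k : ℕ) ≤ n + 1
    · have hτk : τ k = (k : ℝ) + 1 / 2 := by simp only [hτ]; rw [if_pos hk]
      rw [hτk]
      exact rankOne_sign_low n k hk hRn hδ0.le hsmall
    · set i : ℕ := (k : ℕ) - (n + 2) with hi
      have hin : i ≤ n := by omega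
      rcases Nat.mod_two_eq_zero_or_one i with he | ho
      · -- half-odd multiple `(i + ½) R`, `i` even: the top term dominates, sign `-`
        have hτk : τ k = ((i : ℝ) + 1 / 2) * R := by simp only [hτ]; rw [if_neg hk, if_pos he]
        have hodd : Odd ((k : ℕ) + (n + 1)) := Nat.odd_iff.2 (by omega)
        rw [hτk, hodd.neg_one_pow, neg_one_mul]
        exact rankOne_sign_high n i hin (Nat.even_iff.2 he) hR2 hδ0 hbig
      · -- multiple `i R`, `i` odd: a node of `Q`, the determinant is `∝ P(iR) > 0`
        have hτk : τ k = (i : ℝ) * R := by simp only [hτ]; rw [if_neg hk, if_neg (by omega)]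
        have heven : Even ((k : ℕ) + (n + 1)) := Nat.even_iff.2 (by omega)
        rw [hτk, heven.neg_one_pow, one_mul]
        have := rankOne_sign_node n i (by omega) hin hRn ((-1) ^ (n + 1) * δ)
        simpa [mul_assoc] using this
  -- conclude
  refine fullyRealisable_of_certificate _ _ (rankOneDesign_isSymm a μ γ) p heval hdeg τ hτmono hτpos fun j => ?_
  rw [heval, heval, hF, hF]
  have h1 := hsign j.castSucc
  have h2 := hsign j.succ
  simp only [Fin.val_castSucc] at h1
  simp only [Fin.val_succ] at h2
  rw [show (j : ℕ) + 1 + (n + 1) = ((j : ℕ) + (n + 1)) + 1 by ring, pow_succ] at h2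
  set s : ℝ := (-1 : ℝ) ^ ((j : ℕ) + (n + 1)) with hs
  have hss : s * s = 1 := by rw [hs, ← pow_add, ← two_mul, pow_mul]; norm_num
  set F1 : ℝ := (∏ j' : Fin (n + 1), (τ j.castSucc - ((j' : ℝ) + 1)))
      + (-1) ^ (n + 1) * δ * τ j.castSucc ^ (n + 2) * ∏ l : Fin n, (τ j.castSucc - ((l : ℝ) + 1) * R) with hF1
  set F2 : ℝ := (∏ j' : Fin (n + 1), (τ j.succ - ((j' : ℝ) + 1)))
      + (-1) ^ (n + 1) * δ * τ j.succ ^ (n + 2) * ∏ l : Fin n, (τ j.succ - ((l : ℝ) + 1) * R) with hF2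
  have h12 := mul_pos h1 h2
  have hre : s * F1 * (s * -1 * F2) = -(s * s) * (F1 * F2) := by ring
  rw [hre, hss] at h12
  have hneg : F1 * F2 < 0 := by linarith
  have hsq : 0 < (∏ j, μ j) ^ 2 := by positivity
  calc (∏ j, μ j) * F1 * ((∏ j, μ j) * F2) = (∏ j, μ j) ^ 2 * (F1 * F2) := by ring
    _ < 0 := mul_neg_of_pos_of_neg hsq hneg

/-- **The rank-one rung for every size**: `FullyRealisable m ![0, 1, m+1] (2m)` — a real symmetric half-pencil
`S₀ + t S₁ + t^{m+1} S₂` of every size `m` whose determinant has degree exactly `2m` and `2m` distinct positive zeros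
(`m = 0`: the empty pencil, determinant `1`). [folklore] -/
theorem fullyRealisable_rankOneRung (m : ℕ) : FullyRealisable m (![0, 1, m + 1] : Fin 3 → ℕ) (2 * m) := by
  cases m with
  | zero =>
    refine ⟨fun _ => 0, fun _ => Matrix.IsSymm.ext fun i => i.elim0, ?_, ?_⟩
    · unfold IsFullPosRooted
      rw [Matrix.det_isEmpty]
      simp
    · rw [Matrix.det_isEmpty]
      simp
  | succ n =>
    have e1 : n + 1 + 1 = n + 2 := rfl
    have e2 : 2 * (n + 1) = 2 * n + 2 := by ring
    rw [e1, e2]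
    exact fullyRealisable_rankOneRung_succ n

/-! ## §4 Stamp-table readings: `ν(m,3) ≥ 2m` on `(0,1,m+1)`, and `η(m,3) ≥ 4m` by doubling -/

/-- **`ν(m,3) ≥ 2m`** for every `m ≥ 1`: the stamp row `StampLawAt m 3 (2m - 1)` fails (witness: the rank-one rung on
`(0,1,m+1)`). [folklore] -/
theorem not_stampLawAt_rankOneRung (m : ℕ) (hm : 1 ≤ m) : ¬ StampLawAt m 3 (2 * m - 1) := by
  intro h
  obtain ⟨S, hS, hfull, hdeg⟩ := fullyRealisable_rankOneRung m
  have := h _ S hS hfull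
  omega

/-- **`η(m,3) ≥ 4m`** for every `m ≥ 1`: `¬ HypRootLawAt m 3 (4m - 1)` — the rank-one rung doubled
(`not_hypRootLawAt_of_fullyRealisable`, T2 of line «finite»). [folklore] -/
theorem not_hypRootLawAt_rankOneRung (m : ℕ) (hm : 1 ≤ m) : ¬ HypRootLawAt m 3 (4 * m - 1) :=
  not_hypRootLawAt_of_fullyRealisable (fullyRealisable_rankOneRung m) (by omega)

end Summit.ValiantsHypothesis.ValiantsHypothesis.Theorems.LacunarySymmetroidMatrixDescartes.FiniteSector
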